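/-
Origin: expansion seat `prover-pub-hodgecm-mc-sinst-1-g4-0`, handover #1218 2026-08-20T09:16Z md5 a19aba050857 (117 l., 3 theorems) NEW additive leaf after RUN-46 #1217 + (K7) (+ installed (TT)); (J-μ) slots 2/3 junction: slotTypeVec_sub_eq_of_strip_vt (hypotheses ONLY (STRIP) `X' = E(Y ⊗ F)` and (VT) `Y = a • ω_∞(1, conjTransportK c.D) (ctxSlotArchBox …)` ⊢ slotTypeVec 2 − 0 = relabel₀ c.D boxType₀ boxType₁ − boxType₀ ∧ slotTypeVec 3 − 0 = relabel₁ … − boxType₀), slotTypeVec_two_sub_zero_apply_of_strip_vt (… w = if conjSwapAt c.D w then slotDelta c.D w else 0), slotTypeVec_three_sub_zero_apply_of_strip_vt (… w = if conjSwapAt c.D w then 0 else slotDelta c.D w); install AFTER #1217 and (K7); drop with either; NAME LIST: HodgeCM.Model.ArchSideTerm.slotTypeVec_sub_eq_of_strip_vt · HodgeCM.Model.ArchSideTerm.slotTypeVec_two_sub_zero_apply_of_strip_vt · HodgeCM.Model.ArchSideTerm.slotTypeVec_three_sub_zero_apply_of_strip_vt (`HOME/mc/pub-hodgecm-mc-sinst-1-g4/stage/HodgeCM/Model/ArchLineSlotTypeConjClosed.lean`,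 md5 a19aba050857, 117 lines);
landed by the gen-18 packager (p-g18) in gate run 47 as `HodgeCM/Model/ArchLineSlotTypeConjClosed.lean` (verbatim).
-/
/-
Origin: speedrun cell pub-hodgecm, MODEL-CONSTRUCTION sub-cell, lineage mc-sinst-1 (S-instance constructor, BINDER-OWNERS row 5 `S` / row 6 `μ`: (J-μ) slots 2/3),
seat prover-pub-hodgecm-mc-sinst-1-g4-0 (gen 4), 2026-08-20.  Target in PKG: `HodgeCM/Model/ArchLineSlotTypeConjClosed.lean`
(NEW additive leaf; RUN 47 material; imports RUN-46 sinst #1217 `Model/ArchLineSlotTypeConjArch` + RUN-46 theta-3 (K7) `Model/ArchConjTorusTransport`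
+ the installed RUN-44 (TT) `Model/ArchSlotBoxTorusType`; rowdeps #1217, (K7)).
KERNEL only: 0 records / `def … : Prop` / cites, 0 proof holes; intended closure {propext, Classical.choice, Quot.sound}.
-/
import Summits.HodgeConjecture.HodgeCM.Model.ArchLineSlotTypeConjArch
import Summits.HodgeConjecture.HodgeCM.Model.ArchConjTorusTransport_2
import Summits.HodgeConjecture.HodgeCM.Model.ArchSlotBoxTorusType_2

/-!
# (J-μ) SLOTS 2/3: the CLOSED FORM of `hΔ₂` / `hΔ₃` modulo (STRIP) + (VT) — the junction of #1217 with theta-3's (K7)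

#1217 `slotTypeVec_sub_eq_of_conj_transport` reduces the cross-plane (J-μ) identities to (STRIP), (7), (VT) and the plane character's tables;
theta-3-g13's (K7) `ArchConjTorusTransport` SUPPLIES (7) (`ctx_archConjDiag_eq_conjTransport`: `archConjDiag u = conjTransportK · archDiag (conjTorusRelabel u) ·
conjTransportK⁻¹`) and the relabelled tables (`ctx_archWeight_conjTorusRelabel`: `n₂ = relabel₀ boxType₀ boxType₁`, `n₃ = relabel₁ boxType₀ boxType₁`), and
(BT) `ctxSlotArchBox_harch` is the plane character `χ (t₀,t₁) = archWeight boxType₀ t₀ · archWeight boxType₁ t₁`.  Plugging in: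

* **`slotTypeVec_sub_eq_of_strip_vt`** — given ONLY (STRIP) `X' = E(Y ⊗ F)` and (VT) `Y = a • ω_∞(1, conjTransportK c.D) Φ_X`:
  `slotTypeVec 2 − slotTypeVec 0 = relabel₀ c.D boxType₀ boxType₁ − boxType₀` and `slotTypeVec 3 − slotTypeVec 0 = relabel₁ c.D boxType₀ boxType₁ − boxType₀`;
* **`slotTypeVec_two_sub_zero_apply_of_strip_vt`**, **`slotTypeVec_three_sub_zero_apply_of_strip_vt`** — place by place, with (TT)'s
  `pinTorusType₁ − pinTorusType₀ = slotDelta`: `(slotTypeVec 2 − slotTypeVec 0) w = if conjSwapAt c.D w then slotDelta c.D w else 0` and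
  `(slotTypeVec 3 − slotTypeVec 0) w = if conjSwapAt c.D w then 0 else slotDelta c.D w` — theta-3's predicted table (memo §2/§4): the cross-plane
  differences vanish where the lines `⟨dW 0⟩`, `⟨dW' 0⟩` have the same sign at `w` and equal the plane's own `slotDelta` where they do not.
So E's `hΔ₂`/`hΔ₃` (binders of the pins #1212/#1215/#1216 and of glue-1's children) hold for the μ-table `μ c 2 := μ c 0 + (relabel₀ … − boxType₀)`,
`μ c 3 := μ c 0 + (relabel₁ … − boxType₀)` (the (TD) `muSharp` pattern) AS SOON AS (STRIP) and (VT) are supplied — the two remaining archimedean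
inputs, typed exactly as the hypotheses `hstrip` / `hY` below (memo steps (1) and (2)(4)(5): W2-⊗ tensor stripping of `ω(r_F h₀)`; implementer
uniqueness `ArchVacuumSection.eq_relCoeff_smul_of_liftsTo`).  Nothing here is a claim of PerL/QW8; nothing is cited as a fact.
-/

set_option autoImplicit false

noncomputable section

open scoped Matrix Classical SchwartzMap TensorProduct
open NumberField.mixedEmbedding (mixedSpace)
open Literature.NumberTheory.Automorphic Literature.NumberTheory.Automorphic.UnitaryGroup Literature.NumberTheory.Weil1964
open Literature.NumberTheory.GelbartRogawski1991 Literature.NumberTheory.GelbartRogawski1991.UnitaryDualPair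
open HodgeCM.Adelic HodgeCM.PerL34

namespace HodgeCM.Model.ArchSideTerm

section Vec

variable {L : CMField} {ι₁ : L →+* ℂ} (V : HermSpace3 L ι₁) (c : SeesawCtx L)
variable
  (hGR : (cmSplittingDatum (L : Type) finProdFinEquiv (frameD V) (frameD_real V) (frameD_ne V) (dW c.D) (dW_real c.D) (dW_ne c.D)).CompatibleSplitting)
  (hGR₀ : (cmSplittingDatum (L : Type) (e₁) (frameD V) (frameD_real V) (frameD_ne V) (lineVec (L : Type) (dW c.D 0))
    (fun _ => dW_real c.D 0) (fun _ => dW_ne c.D 0)).CompatibleSplitting)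
  (hGR₁ : (cmSplittingDatum (L : Type) (e₁) (frameD V) (frameD_real V) (frameD_ne V) (lineVec (L : Type) (dW c.D 1))
    (fun _ => dW_real c.D 1) (fun _ => dW_ne c.D 1)).CompatibleSplitting)
  (hGR₂ : (cmSplittingDatum (L : Type) (e₁) (frameD V) (frameD_real V) (frameD_ne V) (lineVec (L : Type) (dW' c.D 0))
    (fun _ => dW'_real c.D 0) (fun _ => dW'_ne c.D 0)).CompatibleSplitting)
  (hGR₃ : (cmSplittingDatum (L : Type) (e₁) (frameD V) (frameD_real V) (frameD_ne V) (lineVec (L : Type) (dW' c.D 1))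
    (fun _ => dW'_real c.D 1) (fun _ => dW'_ne c.D 1)).CompatibleSplitting)
  (h₁W : (∀ j, 0 < (ι₁ (dW c.D j)).re) ∨ ∀ j, (ι₁ (dW c.D j)).re < 0)
  (hpos₀ : 0 < HypCensus.cmXW (L : Type) (frameD V) (lineVec (L : Type) (dW c.D 0)) (fun _ => dW_real c.D 0) ι₁ (HypCensus.cmPlace (L : Type) ι₁) 0)
  (hpos₁ : 0 < HypCensus.cmXW (L : Type) (frameD V) (lineVec (L : Type) (dW c.D 1)) (fun _ => dW_real c.D 1) ι₁ (HypCensus.cmPlace (L : Type) ι₁) 0)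
  (hpos₂ : 0 < HypCensus.cmXW (L : Type) (frameD V) (lineVec (L : Type) (dW' c.D 0)) (fun _ => dW'_real c.D 0) ι₁ (HypCensus.cmPlace (L : Type) ι₁) 0)
  (hpos₃ : 0 < HypCensus.cmXW (L : Type) (frameD V) (lineVec (L : Type) (dW' c.D 1)) (fun _ => dW'_real c.D 1) ι₁ (HypCensus.cmPlace (L : Type) ι₁) 0)
  (Y : 𝓢((Fin (3 * 2) → mixedSpace (↥(NumberField.maximalRealSubfield (L : Type)))), ℂ))
  (F : FinSB (↥(NumberField.maximalRealSubfield (L : Type))) (Fin (3 * 2)))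
  (hstrip : cmConjLineTensorFin (L : Type) finProdFinEquiv e₁ (frameD V) (frameD_real V) (frameD_ne V) (dW c.D) (dW_real c.D) (dW_ne c.D)
      (dW' c.D) (dW'_real c.D) (dW'_ne c.D) c.D.isoGL (isoGL_hg₀ c.D)
      (SupplyInstance.testFun (↥(NumberField.maximalRealSubfield (L : Type))) (Fin 3)
        (linePhi V (dW' c.D 0) (dW'_real c.D 0) (dW'_ne c.D 0) hpos₂) (lineX₀ V (dW' c.D 0) (dW'_real c.D 0) (dW'_ne c.D 0) hpos₂) 1)
      (SupplyInstance.testFun (↥(NumberField.maximalRealSubfield (L : Type))) (Fin 3)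
        (linePhi V (dW' c.D 1) (dW'_real c.D 1) (dW'_ne c.D 1) hpos₃) (lineX₀ V (dW' c.D 1) (dW'_real c.D 1) (dW'_ne c.D 1) hpos₃) 1) =
    piSchwartzBruhatEquiv (↥(NumberField.maximalRealSubfield (L : Type))) (Fin (3 * 2)) (Y ⊗ₜ F))
  (a : ℂ)
  (hY : Y = a • HypCensus.cmArchWeilRep (L : Type) finProdFinEquiv (frameD V) (frameD_real V) (frameD_ne V) (dW c.D) (dW_real c.D) (dW_ne c.D) hGR
    (1, conjTransportK c.D) (ctxSlotArchBox V c hpos₀ hpos₁))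

include hstrip hY in
/-- **`hΔ₂` / `hΔ₃` MODULO (STRIP) + (VT)**: the cross-plane slot-type differences are the relabelled box tables minus the first box table. -/
theorem slotTypeVec_sub_eq_of_strip_vt :
    slotTypeVec V c hGR hGR₀ hGR₁ hGR₂ hGR₃ h₁W 2 - slotTypeVec V c hGR hGR₀ hGR₁ hGR₂ hGR₃ h₁W 0 =
        relabel₀ c.D (boxType₀ V c.D hGR h₁W) (boxType₁ V c.D hGR h₁W) - boxType₀ V c.D hGR h₁W ∧
      slotTypeVec V c hGR hGR₀ hGR₁ hGR₂ hGR₃ h₁W 3 - slotTypeVec V c hGR hGR₀ hGR₁ hGR₂ hGR₃ h₁W 0 =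
        relabel₁ c.D (boxType₀ V c.D hGR h₁W) (boxType₁ V c.D hGR h₁W) - boxType₀ V c.D hGR h₁W :=
  slotTypeVec_sub_eq_of_conj_transport V c hGR hGR₀ hGR₁ hGR₂ hGR₃ h₁W hpos₀ hpos₁ hpos₂ hpos₃ Y F hstrip
    (conjTransportK c.D) (conjTorusRelabel c.D) (ctx_archConjDiag_eq_conjTransport c) a hY
    (fun u => archWeight (L : Type) (boxType₀ V c.D hGR h₁W) (NumberField.SeesawArchTorus.fst (L : Type) u) *
      archWeight (L : Type) (boxType₁ V c.D hGR h₁W) (NumberField.SeesawArchTorus.snd (L : Type) u))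
    (fun u => ctxSlotArchBox_harch V c hGR h₁W hpos₀ hpos₁ (NumberField.SeesawArchTorus.fst (L : Type) u) (NumberField.SeesawArchTorus.snd (L : Type) u))
    (boxType₀ V c.D hGR h₁W) (boxType₁ V c.D hGR h₁W)
    (relabel₀ c.D (boxType₀ V c.D hGR h₁W) (boxType₁ V c.D hGR h₁W)) (relabel₁ c.D (boxType₀ V c.D hGR h₁W) (boxType₁ V c.D hGR h₁W))
    (fun _ _ => rfl) (ctx_archWeight_conjTorusRelabel V c hGR h₁W)

include hstrip hY in
/-- **slot 2 place by place, modulo (STRIP) + (VT)**: `Δ₂(w) = 0` where `⟨dW 0⟩` and `⟨dW' 0⟩` have the same sign at `w`, `= slotDelta c.D w` where not. -/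
theorem slotTypeVec_two_sub_zero_apply_of_strip_vt (w : NumberField.InfinitePlace (L : Type)) :
    slotTypeVec V c hGR hGR₀ hGR₁ hGR₂ hGR₃ h₁W 2 w - slotTypeVec V c hGR hGR₀ hGR₁ hGR₂ hGR₃ h₁W 0 w =
      if conjSwapAt c.D w then slotDelta c.D w else 0 := by
  have h := congrFun (slotTypeVec_sub_eq_of_strip_vt V c hGR hGR₀ hGR₁ hGR₂ hGR₃ h₁W hpos₀ hpos₁ hpos₂ hpos₃ Y F hstrip a hY).1 w
  simp only [Pi.sub_apply] at h
  rw [h, relabel₀_sub_apply, ← pinTorusType₁_sub_pinTorusType₀_apply V c.D hGR h₁W hpos₀ hpos₁ w]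
  simp only [boxType₀, boxType₁, Pi.add_apply]
  split_ifs <;> ring

include hstrip hY in
/-- **slot 3 place by place, modulo (STRIP) + (VT)**: `Δ₃(w) = slotDelta c.D w` where `⟨dW 0⟩` and `⟨dW' 0⟩` have the same sign at `w`, `= 0` where not. -/
theorem slotTypeVec_three_sub_zero_apply_of_strip_vt (w : NumberField.InfinitePlace (L : Type)) :
    slotTypeVec V c hGR hGR₀ hGR₁ hGR₂ hGR₃ h₁W 3 w - slotTypeVec V c hGR hGR₀ hGR₁ hGR₂ hGR₃ h₁W 0 w =
      if conjSwapAt c.D w then 0 else slotDelta c.D w := by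
  have h := congrFun (slotTypeVec_sub_eq_of_strip_vt V c hGR hGR₀ hGR₁ hGR₂ hGR₃ h₁W hpos₀ hpos₁ hpos₂ hpos₃ Y F hstrip a hY).2 w
  simp only [Pi.sub_apply] at h
  rw [h, relabel₁_sub_apply, ← pinTorusType₁_sub_pinTorusType₀_apply V c.D hGR h₁W hpos₀ hpos₁ w]
  simp only [boxType₀, boxType₁, Pi.add_apply]
  split_ifs <;> ring

end Vec

end HodgeCM.Model.ArchSideTerm

end
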